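import Literature.Computability.AlgebraicComplexity.KV20Cor13Assembly
import Literature.LinearAlgebra.KernelVectorViaCharpoly
import Mathlib.Algebra.BigOperators.Fin
import Mathlib.Combinatorics.Nullstellensatz
import Mathlib.LinearAlgebra.Matrix.ToLinearEquiv
import HarnessLib

/-!
# Kumar–Volk, Cor. 1.3: the CANONICAL equation `Q_n` — hypothesis (M1) without its existential

Topic `Literature/Computability/AlgebraicComplexity` (namespace
`Literature.Computability.AlgebraicComplexity.KumarVolk2020`). Plumbing definitions with bodies and
theorems; no named fact (D-0026); census +0. Written by the val-lit KV20 roster (x5 g6, OWNER;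
lead-np RULINGS (105)/(106)/(116)) as step (P6)-prep of the M1 programme
(`HOME/np/MEMO-x5g6-KV20-M1-programme.md`).

PRINT. M. Kumar, B. L. Volk [KumarVolk2022], proof of Cor. 1.3 (§6 = arXiv:2003.12938 §5,
p0009:L1–3): "the proof of Theorem 1.2 provides an equation `Q_n` … This polynomial can be found by
solving a linear system of equations in a linear space whose dimension is `exp(poly(n))`. Using
standard, small space algorithm for linear algebra [BvzGH82, ABO99], this implies that there exists
a fixed PSPACE algorithm which, on input `1^n`, outputs the list of coefficients of the polynomial
`Q_n`." The assembly `KumarVolk2020.cor_1_3_of_kit` (`KV20Cor13Assembly.lean`) takes this as the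
hypothesis `hM1 : ∃ Q, coeffBitLanguage Q ∈ PSPACE ∧ …`. THIS FILE REMOVES THE EXISTENTIAL: it
defines ONE explicit family and proves everything about it except the `PSPACE` clause, so that
(M1) becomes the single membership statement `coeffBitLanguage kvCanonicalFamily ∈ PSPACE`
(`cor_1_3_of_canonicalBits`).

CONSTRUCTION (all indices are NUMBERS; no choice anywhere):
* `expOf k E c` / `ptOf t D r`: the exponent vector / grid point whose base-`(E+1)` / base-`(D+1)`
  digits are the column index `c < (E+1)^k` / row index `r < (D+1)^t` (Mathlib's explicit
  `finFunctionFinEquiv`); `polyOfVec k E v = Σ_c v_c · x^{expOf c}`;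
* `evalMat f E D` — the EVALUATION MATRIX of a polynomial map `f : ℤ[x_1..x_k] ← ℤ[y_1..y_t]`:
  entry `(r, c) = ∏_i f_i(ptOf r)^{(expOf c)_i}` (an integer; for `f = Ũ_n` a product of numeric
  evaluations of the universal circuit — `KV20Cor13Assembly`'s evaluation system); its kernel is
  exactly the set of coefficient vectors of equations of `f` with exponents `≤ E` once
  `D ≥ k·E·deg f` (`evalMat_mulVec`, `evalMat_mulVec_eq_zero`, `bind₁_polyOfVec_eq_zero` — Alon's
  Combinatorial Nullstellensatz, `exists_grid_eval_ne_zero'`);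
* `canonEquation f E D := polyOfVec (charpolyKernelVector (evalMatᵀ · evalMat))` — the polynomial
  whose coefficient vector is the canonical kernel vector of the Gram matrix
  (`Literature.LinearAlgebra.KernelVectorViaCharpoly`: least nonzero column of `q_B(B)·B^{j₀−1}`,
  `χ_B = X^k q_B`, by Cayley–Hamilton); `canonEquation_spec`: it is a NONZERO EQUATION of `f` as
  soon as some nonzero equation of degree `≤ E` exists;
* ★ `kvCanonicalEquation n : MvPolynomial (Fin (n·n)) ℤ` := `canonEquation` of `Ũ_n` (flattened to
  `Fin (s+s)` variables, `uFinFlat`) with `E = n³` and `D = kvGridBound n = n²·n³·S(s+1)`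
  (`s = corSize n = n²/200`, `S = |USlot n s|`); ★ `kvCanonicalEquation_spec` (`n ≥ 1`):
  `Q_n ≠ 0 ∧ Q_n ∘ Ũ_n = 0` (existence input = `exists_equation_uFin`, KV Thm 1.2),
  `totalDegree_kvCanonicalEquation_le : deg Q_n ≤ n⁵`;
* ★ `kvCanonicalFamily : ∀ m, MvPolynomial (Fin m) ℤ` (`Q_{√m}` at squares, `0` elsewhere),
  `kvCanonicalFamily_sq`, `kvCanonicalFamily_spec` = the hypothesis `hM1` of `cor_1_3_of_kit` MINUS
  its `PSPACE` clause, for this explicit family;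
* ★ `cor_1_3_of_canonicalBits (kit…) (hbits : coeffBitLanguage kvCanonicalFamily ∈ PSPACE) :
  kumarVolk2020_cor_1_3`.

STATUS / HONEST FRAMING. `kumarVolk2020_cor_1_3` (by name) remains OPEN in the tree: what remains
is exactly `coeffBitLanguage kvCanonicalFamily ∈ PSPACE` — a polynomial-space transducer computing
the bits of the entries of `charpolyKernelVector (AᵀA)` for the succinct matrix `A = evalMat …`
(programme memo, steps (P1)–(P3); UNSTAFFED as a roster target). Nothing here is a new mathematical
claim beyond the print's sentence quoted above made explicit; nothing here bears on `VP ≠ VNP`,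
which is NOT proved.

## References

* [KumarVolk2022] M. Kumar, B. L. Volk, *A polynomial degree bound on equations for non-rigid
  matrices and small linear circuits*, ACM TOCT 14(2) (2022) = arXiv:2003.12938; Cor. 1.3 and its
  proof, §6 (= arXiv §5, p0009:L1–13); Thm. 1.2 (§4.2).
* [BorodinVonzurgathenHopcroft1982] A. Borodin, J. von zur Gathen, J. Hopcroft, Inform. and Control
  52 (1982), §4–§5 (via `Literature.LinearAlgebra.KernelVectorViaCharpoly`).
-/


noncomputable section

namespace Literature.Computability.AlgebraicComplexity

namespace KumarVolk2020

open MvPolynomial Matrix Literature.LinearAlgebra Literature.Computability.Complexity _root_.Computability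

/-! ### Coding exponent vectors and grid points by numbers (explicit digit equivalence) -/

section Coding

variable {k t E D : ℕ}

/-- The exponent vector coded by a column index `c < (E+1)^k`: its base-`(E+1)` digits
(Mathlib's explicit `finFunctionFinEquiv`). [cite: KumarVolk2022, §6 (proof of Cor. 1.3, "the list of coefficients of the polynomial Q_n")] -/
def expOf (k E : ℕ) (c : Fin ((E + 1) ^ k)) : Fin k →₀ ℕ :=
  Finsupp.equivFunOnFinite.symm fun i => (finFunctionFinEquiv.symm c i : ℕ)

/-- Digit `i` of the column index. [cite: KumarVolk2022, §6 (proof of Cor. 1.3)] -/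
@[simp] theorem expOf_apply (c : Fin ((E + 1) ^ k)) (i : Fin k) :
    expOf k E c i = (finFunctionFinEquiv.symm c i : ℕ) := by
  simp [expOf]

/-- Every coded exponent is `≤ E`. [cite: KumarVolk2022, §6 (proof of Cor. 1.3)] -/
theorem expOf_le (c : Fin ((E + 1) ^ k)) (i : Fin k) : expOf k E c i ≤ E := by
  rw [expOf_apply]; exact Nat.lt_succ_iff.1 (Fin.isLt _)

/-- The coding of exponent vectors is injective. [cite: KumarVolk2022, §6 (proof of Cor. 1.3)] -/
theorem expOf_injective : Function.Injective (expOf k E) := by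
  intro c₁ c₂ h
  apply finFunctionFinEquiv.symm.injective
  funext i
  exact Fin.ext (by simpa using congrArg (fun d => d i) h)

/-- Every exponent vector bounded by `E` is coded. [cite: KumarVolk2022, §6 (proof of Cor. 1.3)] -/
theorem exists_expOf_eq (d : Fin k →₀ ℕ) (hd : ∀ i, d i ≤ E) : ∃ c, expOf k E c = d :=
  ⟨finFunctionFinEquiv fun i => ⟨d i, Nat.lt_succ_of_le (hd i)⟩, by ext i; simp⟩

/-- The degree of a coded exponent vector is `≤ k·E`. [cite: KumarVolk2022, §6 (proof of Cor. 1.3)] -/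
theorem degree_expOf_le (c : Fin ((E + 1) ^ k)) : (expOf k E c).degree ≤ k * E := by
  rw [Finsupp.degree_eq_sum]
  calc ∑ i, expOf k E c i ≤ ∑ _i : Fin k, E := Finset.sum_le_sum fun i _ => expOf_le c i
    _ = k * E := by rw [Finset.sum_const, Finset.card_univ, Fintype.card_fin, smul_eq_mul]

/-- The grid point coded by a row index `r < (D+1)^t`: its base-`(D+1)` digits.
[cite: KumarVolk2022, Lemma 15 (proof: "a_1 ∈ {0,1,…,s}")] -/
def ptOf (t D : ℕ) (r : Fin ((D + 1) ^ t)) : Fin t → ℤ :=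
  fun i => ((finFunctionFinEquiv.symm r i : Fin (D + 1)) : ℕ)

/-- Coded grid points lie in `{0, …, D}^t`. [cite: KumarVolk2022, Lemma 15 (proof)] -/
theorem ptOf_bounds (r : Fin ((D + 1) ^ t)) (i : Fin t) : 0 ≤ ptOf t D r i ∧ ptOf t D r i ≤ D :=
  ⟨Int.natCast_nonneg _, Int.ofNat_le.2 (Nat.lt_succ_iff.1 (Fin.isLt _))⟩

/-- `|ptOf r i| ≤ D`. [cite: KumarVolk2022, Lemma 15 (proof)] -/
theorem natAbs_ptOf_le (r : Fin ((D + 1) ^ t)) (i : Fin t) : (ptOf t D r i).natAbs ≤ D := by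
  unfold ptOf
  rw [Int.natAbs_natCast]
  exact Nat.lt_succ_iff.1 (Fin.isLt _)

/-- Every point of `{0, …, D}^t` is coded. [cite: KumarVolk2022, Lemma 15 (proof)] -/
theorem exists_ptOf_eq (z : Fin t → ℤ) (hz : ∀ i, 0 ≤ z i ∧ z i ≤ D) : ∃ r, ptOf t D r = z := by
  refine ⟨finFunctionFinEquiv fun i => ⟨(z i).toNat, ?_⟩, funext fun i => ?_⟩
  · have := (hz i).2; omega
  · simp only [ptOf, Equiv.symm_apply_apply]
    exact Int.toNat_of_nonneg (hz i).1

/-! ### Coefficient vectors ↔ polynomials with exponents `≤ E` -/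

/-- The polynomial with coefficient vector `v` (indexed by coded exponent vectors).
[cite: KumarVolk2022, §6 (proof of Cor. 1.3, "the list of coefficients of the polynomial Q_n")] -/
def polyOfVec (k E : ℕ) (v : Fin ((E + 1) ^ k) → ℤ) : MvPolynomial (Fin k) ℤ :=
  ∑ c, monomial (expOf k E c) (v c)

/-- The coefficient of the monomial coded by `c` is `v c`. [cite: KumarVolk2022, §6 (proof of Cor. 1.3)] -/
theorem coeff_polyOfVec_expOf (v : Fin ((E + 1) ^ k) → ℤ) (c : Fin ((E + 1) ^ k)) :
    coeff (expOf k E c) (polyOfVec k E v) = v c := by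
  classical
  rw [polyOfVec, coeff_sum]
  simp_rw [coeff_monomial, expOf_injective.eq_iff]
  rw [Finset.sum_ite_eq' Finset.univ c v, if_pos (Finset.mem_univ _)]

/-- Coefficients at uncoded (i.e. some exponent `> E`) monomials vanish.
[cite: KumarVolk2022, §6 (proof of Cor. 1.3)] -/
theorem coeff_polyOfVec_of_forall_ne (v : Fin ((E + 1) ^ k) → ℤ) {d : Fin k →₀ ℕ}
    (hd : ∀ c, expOf k E c ≠ d) : coeff d (polyOfVec k E v) = 0 := by
  classical
  rw [polyOfVec, coeff_sum]
  exact Finset.sum_eq_zero fun c _ => by rw [coeff_monomial, if_neg (hd c)]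

/-- `polyOfVec v = 0 ↔ v = 0`. [cite: KumarVolk2022, §6 (proof of Cor. 1.3)] -/
theorem polyOfVec_eq_zero_iff (v : Fin ((E + 1) ^ k) → ℤ) : polyOfVec k E v = 0 ↔ v = 0 := by
  constructor
  · intro h
    funext c
    rw [← coeff_polyOfVec_expOf v c, h, coeff_zero]
    rfl
  · rintro rfl
    exact Finset.sum_eq_zero fun c _ => map_zero _

/-- `deg (polyOfVec v) ≤ k·E`. [cite: KumarVolk2022, §6 (proof of Cor. 1.3)] -/
theorem totalDegree_polyOfVec_le (v : Fin ((E + 1) ^ k) → ℤ) :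
    (polyOfVec k E v).totalDegree ≤ k * E := by
  classical
  refine (totalDegree_finsetSum _ _).trans (Finset.sup_le fun c _ => ?_)
  refine (totalDegree_monomial_le _ _).trans ?_
  exact (degree_expOf_le c).trans_eq' (Finsupp.degree_apply _).symm

/-- A polynomial all of whose exponents are `≤ E` is `polyOfVec` of its coefficient vector.
[cite: KumarVolk2022, §6 (proof of Cor. 1.3)] -/
theorem polyOfVec_coeff (P : MvPolynomial (Fin k) ℤ) (hP : ∀ d ∈ P.support, ∀ i, d i ≤ E) :
    polyOfVec k E (fun c => coeff (expOf k E c) P) = P := by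
  classical
  ext d
  by_cases h : ∃ c, expOf k E c = d
  · obtain ⟨c, rfl⟩ := h
    exact coeff_polyOfVec_expOf _ c
  · push Not at h
    rw [coeff_polyOfVec_of_forall_ne _ h]
    by_contra hne
    obtain ⟨c, hc⟩ := exists_expOf_eq d (hP d (mem_support_iff.2 (Ne.symm hne)))
    exact h c hc

/-! ### The evaluation matrix of a polynomial map and its kernel -/

/-- **The evaluation matrix** of `f = (f_1, …, f_k)`, `f_i ∈ ℤ[y_1, …, y_t]`: rows = coded grid
points `z ∈ {0,…,D}^t`, columns = coded exponent vectors `α ≤ E`, entry `∏_i f_i(z)^{α_i}`.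
[cite: KumarVolk2022, §6 (proof of Cor. 1.3, "solving a linear system of equations")] -/
def evalMat (f : Fin k → MvPolynomial (Fin t) ℤ) (E D : ℕ) :
    Matrix (Fin ((D + 1) ^ t)) (Fin ((E + 1) ^ k)) ℤ :=
  fun r c => ∏ i, eval (ptOf t D r) (f i) ^ expOf k E c i

/-- `(evalMat · v)_z = (polyOfVec v ∘ f)(z)`: the matrix acts as "compose with `f`, evaluate at the
grid point". [cite: KumarVolk2022, §6 (proof of Cor. 1.3)] -/
theorem evalMat_mulVec (f : Fin k → MvPolynomial (Fin t) ℤ) (v : Fin ((E + 1) ^ k) → ℤ)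
    (r : Fin ((D + 1) ^ t)) :
    (evalMat f E D *ᵥ v) r = eval (ptOf t D r) (bind₁ f (polyOfVec k E v)) := by
  classical
  rw [show eval (ptOf t D r) (bind₁ f (polyOfVec k E v)) =
      eval (fun i => eval (ptOf t D r) (f i)) (polyOfVec k E v) from eval₂Hom_bind₁ _ _ _ _]
  rw [polyOfVec, map_sum]
  simp only [mulVec, dotProduct, evalMat, eval_monomial]
  refine Finset.sum_congr rfl fun c _ => ?_
  rw [mul_comm, Finsupp.prod_fintype _ _ fun i => pow_zero _]

/-- An equation gives a kernel vector: `polyOfVec v ∘ f = 0 ⇒ evalMat · v = 0`.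
[cite: KumarVolk2022, §6 (proof of Cor. 1.3)] -/
theorem evalMat_mulVec_eq_zero (f : Fin k → MvPolynomial (Fin t) ℤ) {v : Fin ((E + 1) ^ k) → ℤ}
    (h : bind₁ f (polyOfVec k E v) = 0) : evalMat f E D *ᵥ v = 0 := by
  funext r
  rw [evalMat_mulVec, h, map_zero]
  rfl

/-- **A kernel vector gives an equation** when the grid is large enough (`D ≥ k·E·deg f`; Alon's
Combinatorial Nullstellensatz). [cite: KumarVolk2022, §6 (proof of Cor. 1.3)] -/
theorem bind₁_polyOfVec_eq_zero (f : Fin k → MvPolynomial (Fin t) ℤ) {Df : ℕ}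
    (hf : ∀ i, (f i).totalDegree ≤ Df) (hD : k * E * Df ≤ D) {v : Fin ((E + 1) ^ k) → ℤ}
    (h : evalMat f E D *ᵥ v = 0) : bind₁ f (polyOfVec k E v) = 0 := by
  by_contra hne
  have hdeg : (bind₁ f (polyOfVec k E v)).totalDegree ≤ D :=
    (totalDegree_bind₁_le f hf _).trans
      ((Nat.mul_le_mul_right _ (totalDegree_polyOfVec_le v)).trans hD)
  obtain ⟨z, hz, hne'⟩ := exists_grid_eval_ne_zero' _ hne hdeg
  obtain ⟨r, rfl⟩ := exists_ptOf_eq z hz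
  exact hne' (by rw [← evalMat_mulVec, h]; rfl)

/-- A nonzero equation of degree `≤ E` yields a nonzero kernel vector of `evalMat`.
[cite: KumarVolk2022, §6 (proof of Cor. 1.3)] -/
theorem exists_mulVec_evalMat_eq_zero (f : Fin k → MvPolynomial (Fin t) ℤ)
    {P : MvPolynomial (Fin k) ℤ} (hP0 : P ≠ 0) (hPE : P.totalDegree ≤ E) (hU : bind₁ f P = 0) :
    ∃ v : Fin ((E + 1) ^ k) → ℤ, v ≠ 0 ∧ evalMat f E D *ᵥ v = 0 := by
  have hP : polyOfVec k E (fun c => coeff (expOf k E c) P) = P :=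
    polyOfVec_coeff P fun d hd i =>
      (monomial_le_degreeOf i hd).trans ((degreeOf_le_totalDegree P i).trans hPE)
  refine ⟨fun c => coeff (expOf k E c) P, fun h0 => hP0 ?_, evalMat_mulVec_eq_zero f (by rw [hP, hU])⟩
  rw [← hP, h0]
  exact (polyOfVec_eq_zero_iff _).2 rfl

/-! ### The canonical equation of a polynomial map -/

/-- **The canonical equation** of the map `f` with exponent bound `E` and grid bound `D`: the
polynomial whose coefficient vector is the canonical kernel vector
(`Literature.LinearAlgebra.charpolyKernelVector`, least nonzero column of `q_B(B)·B^{j₀−1}`) of the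
Gram matrix `B = evalMatᵀ · evalMat`. [cite: KumarVolk2022, §6 (proof of Cor. 1.3, "This polynomial can be found by solving a linear system … small space algorithm for linear algebra [BvzGH82, ABO99]")] -/
def canonEquation (f : Fin k → MvPolynomial (Fin t) ℤ) (E D : ℕ) : MvPolynomial (Fin k) ℤ :=
  polyOfVec k E (charpolyKernelVector ((evalMat f E D)ᵀ * evalMat f E D))

/-- `deg (canonEquation f E D) ≤ k·E`. [cite: KumarVolk2022, §6 (proof of Cor. 1.3)] -/
theorem totalDegree_canonEquation_le (f : Fin k → MvPolynomial (Fin t) ℤ) (E D : ℕ) :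
    (canonEquation f E D).totalDegree ≤ k * E :=
  totalDegree_polyOfVec_le _

/-- **The canonical equation is a nonzero equation** as soon as SOME nonzero equation of degree
`≤ E` exists and the grid is large enough. [cite: KumarVolk2022, §6 (proof of Cor. 1.3)] -/
theorem canonEquation_spec (f : Fin k → MvPolynomial (Fin t) ℤ) {Df : ℕ}
    (hf : ∀ i, (f i).totalDegree ≤ Df) (hD : k * E * Df ≤ D)
    (hex : ∃ P : MvPolynomial (Fin k) ℤ, P ≠ 0 ∧ P.totalDegree ≤ E ∧ bind₁ f P = 0) :
    canonEquation f E D ≠ 0 ∧ bind₁ f (canonEquation f E D) = 0 := by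
  obtain ⟨P, hP0, hPE, hU⟩ := hex
  obtain ⟨v, hv, hAv⟩ := exists_mulVec_evalMat_eq_zero f (D := D) hP0 hPE hU
  haveI : Nonempty (Fin ((E + 1) ^ k)) := ⟨⟨0, pow_pos (Nat.succ_pos E) k⟩⟩
  obtain ⟨hne, hker⟩ := charpolyKernelVector_gram_spec (evalMat f E D) hv hAv
  exact ⟨fun h => hne ((polyOfVec_eq_zero_iff _).1 h), bind₁_polyOfVec_eq_zero f hf hD hker⟩

/-- **All coefficients of `polyOfVec v`**: at an exponent vector bounded by `E` the coefficient is
the entry of `v` at its digit code, otherwise `0`. [cite: KumarVolk2022, §6 (proof of Cor. 1.3, "the list of coefficients")] -/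
theorem coeff_polyOfVec (v : Fin ((E + 1) ^ k) → ℤ) (d : Fin k →₀ ℕ) :
    coeff d (polyOfVec k E v) =
      if h : ∀ i, d i ≤ E then v (finFunctionFinEquiv fun i => ⟨d i, Nat.lt_succ_of_le (h i)⟩)
      else 0 := by
  split_ifs with h
  · set c₀ : Fin ((E + 1) ^ k) := finFunctionFinEquiv fun i => ⟨d i, Nat.lt_succ_of_le (h i)⟩
      with hc₀
    have hc : expOf k E c₀ = d := by ext i; simp [hc₀]
    calc coeff d (polyOfVec k E v) = coeff (expOf k E c₀) (polyOfVec k E v) := by rw [hc]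
      _ = v c₀ := coeff_polyOfVec_expOf v c₀
  · push Not at h
    obtain ⟨i, hi⟩ := h
    exact coeff_polyOfVec_of_forall_ne v fun c hc => (expOf_le c i).not_gt (hc ▸ hi)

end Coding

/-! ### The canonical Kumar–Volk equation `Q_n` and the family `m ↦ Q_{√m}` -/

section KV

/-- `Ũ_n` with its `2s` variables flattened to `Fin (s + s)` (`finSumFinEquiv`).
[cite: KumarVolk2022, Thm. 1.2 (proof, §4.2)] -/
def uFinFlat (n : ℕ) (q : Fin (n * n)) : MvPolynomial (Fin (corSize n + corSize n)) ℤ :=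
  rename finSumFinEquiv (uFin n q)

/-- `P ∘ uFinFlat = rename (P ∘ uFin)`. [cite: KumarVolk2022, Thm. 1.2 (proof, §4.2)] -/
theorem bind₁_uFinFlat (n : ℕ) (P : MvPolynomial (Fin (n * n)) ℤ) :
    bind₁ (uFinFlat n) P = rename finSumFinEquiv (bind₁ (uFin n) P) :=
  (rename_bind₁ _ _ _).symm

/-- `P ∘ uFinFlat = 0 ↔ P ∘ uFin = 0`. [cite: KumarVolk2022, Thm. 1.2 (proof, §4.2)] -/
theorem bind₁_uFinFlat_eq_zero_iff (n : ℕ) (P : MvPolynomial (Fin (n * n)) ℤ) :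
    bind₁ (uFinFlat n) P = 0 ↔ bind₁ (uFin n) P = 0 := by
  rw [bind₁_uFinFlat]
  constructor
  · intro h
    exact rename_injective _ finSumFinEquiv.injective (by rw [h, map_zero])
  · intro h
    rw [h, map_zero]

/-- `deg (uFinFlat n)_q ≤ S·(s+1)`. [cite: KumarVolk2022, Thm. 1.2 (proof, §4.2)] -/
theorem totalDegree_uFinFlat_le (n : ℕ) (q : Fin (n * n)) :
    (uFinFlat n q).totalDegree ≤ Fintype.card (USlot n (corSize n)) * (corSize n + 1) :=
  (totalDegree_rename_le _ _).trans (totalDegree_uFin_le n q)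

/-- The grid bound of the canonical system: `D_n = n²·n³·(S(s+1))` (`≥ deg(Q ∘ Ũ_n)` for every `Q`
with exponents `≤ n³`). [cite: KumarVolk2022, §6 (proof of Cor. 1.3)] -/
def kvGridBound (n : ℕ) : ℕ :=
  n * n * n ^ 3 * (Fintype.card (USlot n (corSize n)) * (corSize n + 1))

/-- ★ **The canonical Kumar–Volk equation `Q_n ∈ ℤ[x_1, …, x_{n²}]`**: the canonical equation of
`Ũ_n` (flattened) with exponent bound `n³` and grid bound `kvGridBound n` — an EXPLICIT polynomial
(no choice): its coefficient at the exponent vector with base-`(n³+1)` digits `c` is entry `c` of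
`charpolyKernelVector (AᵀA)`, `A = evalMat (uFinFlat n) (n^3) (kvGridBound n)`.
[cite: KumarVolk2022, §6 (proof of Cor. 1.3, "outputs the list of coefficients of the polynomial Q_n")] -/
def kvCanonicalEquation (n : ℕ) : MvPolynomial (Fin (n * n)) ℤ :=
  canonEquation (uFinFlat n) (n ^ 3) (kvGridBound n)

/-- `deg Q_n ≤ n²·n³`. [cite: KumarVolk2022, §6 (proof of Cor. 1.3)] -/
theorem totalDegree_kvCanonicalEquation_le (n : ℕ) :
    (kvCanonicalEquation n).totalDegree ≤ n * n * n ^ 3 :=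
  totalDegree_canonEquation_le _ _ _

/-- ★ **`Q_n` is a nonzero equation of `Ũ_n`** for `n ≥ 1` (existence input:
`exists_equation_uFin`, i.e. KV Thm 1.2's dimension count). [cite: KumarVolk2022, §6 (proof of Cor. 1.3) + Thm. 1.2] -/
theorem kvCanonicalEquation_spec {n : ℕ} (hn : 1 ≤ n) :
    kvCanonicalEquation n ≠ 0 ∧ bind₁ (uFin n) (kvCanonicalEquation n) = 0 := by
  obtain ⟨P, hP0, hdeg, hU⟩ := exists_equation_uFin hn
  have h := canonEquation_spec (uFinFlat n) (E := n ^ 3) (D := kvGridBound n)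
    (totalDegree_uFinFlat_le n) le_rfl ⟨P, hP0, hdeg, (bind₁_uFinFlat_eq_zero_iff n P).2 hU⟩
  exact ⟨h.1, (bind₁_uFinFlat_eq_zero_iff n _).1 h.2⟩

/-- ★ **The canonical family** `m ↦ Q_{√m}` (transported along `m = (√m)²`; `0` at non-squares).
[cite: KumarVolk2022, §6 (proof of Cor. 1.3, "the family {Q_n} ∈ PSPACE")] -/
def kvCanonicalFamily (m : ℕ) : MvPolynomial (Fin m) ℤ :=
  if h : Nat.sqrt m * Nat.sqrt m = m then rename (Fin.cast h) (kvCanonicalEquation (Nat.sqrt m))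
  else 0

/-- At squares the family is `Q_n`. [cite: KumarVolk2022, §6 (proof of Cor. 1.3)] -/
theorem kvCanonicalFamily_sq (n : ℕ) : kvCanonicalFamily (n * n) = kvCanonicalEquation n := by
  have key : ∀ k, k = n → ∀ h : k * k = n * n,
      rename (Fin.cast h) (kvCanonicalEquation k) = kvCanonicalEquation n := by
    rintro k rfl h
    have hc : (Fin.cast h : Fin (k * k) → Fin (k * k)) = id := funext fun i => Fin.ext rfl
    rw [hc, rename_id]
    rfl
  unfold kvCanonicalFamily
  rw [dif_pos (show Nat.sqrt (n * n) * Nat.sqrt (n * n) = n * n by rw [Nat.sqrt_eq])]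
  exact key _ (Nat.sqrt_eq n) _

/-- The family has p-bounded degree (`≤ m³ + 3`). [cite: KumarVolk2022, §6 (proof of Cor. 1.3)] -/
theorem isPBounded_totalDegree_kvCanonicalFamily :
    IsPBounded fun m => (kvCanonicalFamily m).totalDegree := by
  refine ⟨3, fun m => ?_⟩
  by_cases h : Nat.sqrt m * Nat.sqrt m = m
  · simp only [kvCanonicalFamily, dif_pos h]
    refine (totalDegree_rename_le _ _).trans ((totalDegree_kvCanonicalEquation_le _).trans ?_)
    set k := Nat.sqrt m
    rw [← h]
    rcases Nat.eq_zero_or_pos k with hk | hk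
    · rw [hk]; simp
    · calc k * k * k ^ 3 = k ^ 5 := by ring
        _ ≤ k ^ 6 := Nat.pow_le_pow_right hk (by norm_num)
        _ = (k * k) ^ 3 := by ring
        _ ≤ (k * k) ^ 3 + 3 := Nat.le_add_right _ _
  · simp only [kvCanonicalFamily, dif_neg h, totalDegree_zero]
    exact Nat.zero_le _

/-- ★ **(M1) minus `PSPACE`, constructively**: the canonical family has p-bounded degree and
`kvCanonicalFamily (n·n) = Q_n` is a nonzero equation of `Ũ_n` for every `n ≥ 1`.
[cite: KumarVolk2022, §6 (proof of Cor. 1.3)] -/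
theorem kvCanonicalFamily_spec :
    IsPBounded (fun m => (kvCanonicalFamily m).totalDegree) ∧
      ∃ n₀ : ℕ, ∀ n, n₀ ≤ n →
        kvCanonicalFamily (n * n) ≠ 0 ∧ bind₁ (uFin n) (kvCanonicalFamily (n * n)) = 0 :=
  ⟨isPBounded_totalDegree_kvCanonicalFamily, 1, fun n hn => by
    rw [kvCanonicalFamily_sq]; exact kvCanonicalEquation_spec hn⟩

/-- ★ **Cor. 1.3 from ONE membership statement**: with the certificate kit of `cor_1_3_of_kit`,
`kumarVolk2020_cor_1_3` follows from `coeffBitLanguage kvCanonicalFamily ∈ PSPACE` — the bits of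
the coefficients of the EXPLICIT polynomials `Q_n` are computable in polynomial space (what the
M1 transducer has to do; no existential left to instantiate).
[cite: KumarVolk2022, Cor. 1.3 (proof, §6: "there exists a fixed PSPACE algorithm which, on input 1ⁿ, outputs the list of coefficients of the polynomial Q_n")] -/
theorem cor_1_3_of_canonicalBits (R : Language Bool) (ptList : List Bool → List Bool)
    (hR : PITLanguage ∈ Classes.P → R ∈ Classes.P) (hpt : ptList ∈ FP)
    (hsound : ∀ (n : ℕ) (w : List Bool), boolPair (unaryEncodeNat n) w ∈ R →
      ∃ (P : MvPolynomial (Fin (n * n)) ℤ) (a : Fin (n * n) → ℤ),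
        bind₁ (uFin n) P = 0 ∧ eval a P ≠ 0 ∧
          encodingIntBool.listBool.decode (ptList (boolPair (unaryEncodeNat n) w)) =
            some (List.ofFn a))
    (hcomplete : ∃ c₀ : ℕ, ∀ (n : ℕ) (C : ArithCircuit ℤ (Fin (n * n))) (a : Fin (n * n) → ℤ)
      (A : ℕ), C.IsFanInTwo → C.HasSignConstants → bind₁ (uFin n) C.eval = 0 → eval a C.eval ≠ 0 →
        (∀ q, 0 ≤ a q ∧ a q ≤ A) →
          ∃ w : List Bool, w.length ≤ (n + C.size + A) ^ c₀ + c₀ ∧ boolPair (unaryEncodeNat n) w ∈ R)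
    (hbits : coeffBitLanguage kvCanonicalFamily ∈ PSPACE) : kumarVolk2020_cor_1_3 :=
  cor_1_3_of_kit R ptList hR hpt hsound hcomplete ⟨kvCanonicalFamily, hbits, kvCanonicalFamily_spec⟩

/-- **The coefficients of `Q_n`, explicitly**: at an exponent vector `d` with all `d_i ≤ n³`, the
coefficient is entry `code(d)` (base-`(n³+1)` digits) of the canonical kernel vector of the Gram
matrix of the evaluation matrix; otherwise `0`. (The interface the M1 transducer's correctness
proof unfolds.) [cite: KumarVolk2022, §6 (proof of Cor. 1.3, "outputs the list of coefficients of the polynomial Q_n")] -/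
theorem coeff_kvCanonicalEquation (n : ℕ) (d : Fin (n * n) →₀ ℕ) :
    coeff d (kvCanonicalEquation n) =
      if h : ∀ i, d i ≤ n ^ 3 then
        charpolyKernelVector
          ((evalMat (uFinFlat n) (n ^ 3) (kvGridBound n))ᵀ * evalMat (uFinFlat n) (n ^ 3) (kvGridBound n))
          (finFunctionFinEquiv fun i => ⟨d i, Nat.lt_succ_of_le (h i)⟩)
      else 0 :=
  coeff_polyOfVec _ d

/-- At non-squares the family is `0`. [cite: KumarVolk2022, §6 (proof of Cor. 1.3)] -/
theorem kvCanonicalFamily_of_not_sq {m : ℕ} (h : Nat.sqrt m * Nat.sqrt m ≠ m) :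
    kvCanonicalFamily m = 0 := by
  unfold kvCanonicalFamily
  rw [dif_neg h]

/-- The `coeffBitLanguage` query semantics at squares: `coeffOfList kvCanonicalFamily (n·n) e` is
the coefficient of `Q_n` at the exponent vector read off the list `e`.
[cite: KumarVolk2022, Cor. 1.3 (item 1)] -/
theorem coeffOfList_kvCanonicalFamily_sq (n : ℕ) (e : List ℕ) :
    coeffOfList kvCanonicalFamily (n * n) e =
      coeff (Finsupp.equivFunOnFinite.symm fun i : Fin (n * n) => e.getD i.1 0)
        (kvCanonicalEquation n) := by
  unfold coeffOfList
  rw [kvCanonicalFamily_sq]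

/-- … and at non-squares every query coefficient is `0`. [cite: KumarVolk2022, Cor. 1.3 (item 1)] -/
theorem coeffOfList_kvCanonicalFamily_of_not_sq {m : ℕ} (h : Nat.sqrt m * Nat.sqrt m ≠ m)
    (e : List ℕ) : coeffOfList kvCanonicalFamily m e = 0 := by
  unfold coeffOfList
  rw [kvCanonicalFamily_of_not_sq h, coeff_zero]

/-- Nonzero integer multiples of the canonical family are just as good (a transducer may clear
denominators by a nonzero constant `c m` depending on `m`): p-bounded degree, and `c(n²)·Q_n` is a
nonzero equation of `Ũ_n` for `n ≥ 1`. [cite: KumarVolk2022, §6 (proof of Cor. 1.3)] -/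
theorem kvCanonicalFamily_smul_spec (c : ℕ → ℤ) (hc : ∀ m, c m ≠ 0) :
    IsPBounded (fun m => (c m • kvCanonicalFamily m).totalDegree) ∧
      ∃ n₀ : ℕ, ∀ n, n₀ ≤ n →
        c (n * n) • kvCanonicalFamily (n * n) ≠ 0 ∧
          bind₁ (uFin n) (c (n * n) • kvCanonicalFamily (n * n)) = 0 := by
  obtain ⟨⟨e, he⟩, n₀, hn₀⟩ := kvCanonicalFamily_spec
  refine ⟨⟨e, fun m => (totalDegree_smul_le _ _).trans (he m)⟩, n₀, fun n hn => ?_⟩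
  obtain ⟨h0, hU⟩ := hn₀ n hn
  refine ⟨fun h => h0 ((smul_eq_zero.1 h).resolve_left (hc _)), ?_⟩
  rw [smul_eq_C_mul, map_mul, bind₁_C_right, hU, mul_zero]

/-- ★ Cor. 1.3 from the bits of ANY nonzero-constant multiple of the canonical family.
[cite: KumarVolk2022, Cor. 1.3 (proof, §6)] -/
theorem cor_1_3_of_scaledCanonicalBits (R : Language Bool) (ptList : List Bool → List Bool)
    (hR : PITLanguage ∈ Classes.P → R ∈ Classes.P) (hpt : ptList ∈ FP)
    (hsound : ∀ (n : ℕ) (w : List Bool), boolPair (unaryEncodeNat n) w ∈ R →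
      ∃ (P : MvPolynomial (Fin (n * n)) ℤ) (a : Fin (n * n) → ℤ),
        bind₁ (uFin n) P = 0 ∧ eval a P ≠ 0 ∧
          encodingIntBool.listBool.decode (ptList (boolPair (unaryEncodeNat n) w)) =
            some (List.ofFn a))
    (hcomplete : ∃ c₀ : ℕ, ∀ (n : ℕ) (C : ArithCircuit ℤ (Fin (n * n))) (a : Fin (n * n) → ℤ)
      (A : ℕ), C.IsFanInTwo → C.HasSignConstants → bind₁ (uFin n) C.eval = 0 → eval a C.eval ≠ 0 →
        (∀ q, 0 ≤ a q ∧ a q ≤ A) →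
          ∃ w : List Bool, w.length ≤ (n + C.size + A) ^ c₀ + c₀ ∧ boolPair (unaryEncodeNat n) w ∈ R)
    (c : ℕ → ℤ) (hc : ∀ m, c m ≠ 0)
    (hbits : coeffBitLanguage (fun m => c m • kvCanonicalFamily m) ∈ PSPACE) :
    kumarVolk2020_cor_1_3 :=
  cor_1_3_of_kit R ptList hR hpt hsound hcomplete
    ⟨fun m => c m • kvCanonicalFamily m, hbits, kvCanonicalFamily_smul_spec c hc⟩

end KV

end KumarVolk2020

end Literature.Computability.AlgebraicComplexity
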